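import Mathlib
import HarnessLib
import HarnessLib.Audit
import Summits.AtomisticToContinuum.Statement
import Literature.MathematicalPhysics.KineticTheory.InfiniteChainDynamics
import Literature.Barriers.AtomisticToContinuum.MacroErgodicityHypothesis
import Literature.MathematicalPhysics.KineticTheory.LangevinChainNESSHolds
import Summits.AtomisticToContinuum.FouriersLaw.Theorems.EmbeddedDrudeMourreNessUnique
import Summits.AtomisticToContinuum.FouriersLaw.Theorems.FourierGreenKuboFourierFiniteResponseOfUnique

/-!
Route: CurrentTiltRigidity

CLOSED (retired) 2026-08-15T13:41:42Z by operator:999:1257524 — reason: not-a-thesis: assembly does not conclude the sub-problem Statement — note: D-0027 §2.1 audit (human 2026-08-15: routes that do not decide the summit are removed): the assembly concludes `Literature.MathematicalPhysics.KineticTheory.HeatConduction.FouriersLaw`, not the sub-problem statement; a NEW conforming route may be opened from the same idea (generated `closes : … → _r. The file is kept as the record of this route; refuted decls are indexed as negative knowledge (`ledger negatives`).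

# Route CurrentTiltRigidity — bias the Gibbs state by the clipped current, quench and Cesàro-average
— odd-sector rigidity then forbids a Drude weight, and the bridge is one uniform-in-time
second-order response bound

X_CT (CURRENT-TILT RIGIDITY LINE; realises idea card doob-tilt-macroergodicity-bridge, REPAIRED
after its novelty audit). Fix
pinnedChain ω₂ lam β γ (ω₂, lam, β > 0; γ is inert for the infinite chain), T > 0, a shift- and
momentum-reversal-invariant Gibbs state
μ_T of the INFINITE chain and a μ_T-preserving, shift-covariant infinite-volume dynamics φ
(InfiniteChainDynamics; existence = support
SymmetricSetup). Clip the bond current at level M, F_M(u) = max(−M, min(M, u)); bias μ_T by the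
bounded local weight
exp(ε Σ_{|x|≤L} F_M(j_x)) (a current-carrying perturbed Gibbs state ν_{ε,L}), let φ act,
Cesàro-average over [0, τ]. It suffices to show
X_CT = X1 ∧ X2 ∧ X3 ∧ X4 (plus the shared finite-N items):
 X1 (UniformQuadraticResponse, crux 2): the Cesàro-averaged clipped current after the quench equals
its Kubo first-order term ε·A_M(L,τ),
    A_M(L,τ) = τ⁻¹∫₀^τ Cov_{μ_T}(Σ_{|x|≤L} F_M(j_x), F_M(j_0)∘φ_t) dt, up to K·ε², UNIFORMLY in τ ≥
1 and in L;
 X2 (QuenchCurrentDies, crux 4): if every shift-invariant, time-invariant, regular state gives zero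
mean to F_M(j_0), the Cesàro-averaged
    quench current tends to 0 (τ → ∞, then L → ∞) — compactness: limit points of the averaged quench
states are exactly such states;
 X3 (BoundedOddRigidity, crux 3): the ODD SECTOR of macro-ergodicity — every shift-invariant,
time-invariant (∫𝒜f dν = 0), regular
    probability measure of the infinite pinned chain has ∫ F_M(j_0) dν = 0 for every M (implies
ZeroCurrentRigidity = stmt-2739 of route
    LocalOhmRigidity: support OddRigidityTransfer, proved in the planner sketch);
 X4 (GreenKuboOfNoDrude, crux 5, import slot): Green–Kubo for the infinite chain (body of stmt-0703
at T) GIVEN that all truncated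
    Drude weights vanish.
X1 ∧ X2 ∧ X3 give NoTruncatedDrude (the deliverable: no ballistic channel; = zero Drude weight
σ_T({0}) = 0 by support
DrudeFromTruncation; glue BridgeGlue proved in the sketch), X4 converts it into stmt-0703, and
NessUnique (stmt-0741),
FiniteResponseOfUnique (stmt-0717), ThermodynamicLimit (stmt-0742) finish exactly as in route
FourierGreenKubo. Contrapositively and
WITHOUT X3, X1 ∧ X2 prove the card's structure theorem FluctuationStateDichotomy: a positive
truncated Drude weight manufactures a regular,
space-time-invariant, current-carrying (hence non-Gibbsian) state out of equilibrium current
fluctuations.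
Lean: `UniformQuadraticResponse ∧ QuenchCurrentDies ∧ BoundedOddRigidity ∧ GreenKuboOfNoDrude ∧
NessUnique ∧ FiniteResponseOfUnique ∧ ThermodynamicLimit`

## Assembly
Glue PROVED in the planner's Sketch.lean (theorem assembly : Assembly, rc 0, ~30 lines): clause (i)
of FouriersLawFor from the landed fact
via Literature.MathematicalPhysics.KineticTheory.HeatConduction.pinnedChain_exists_isSteadyState +
NessUnique; for every T > 0 the bridge
(theorem bridgeGlue: UniformQuadraticResponse → QuenchCurrentDies → BoundedOddRigidity →
NoTruncatedDrude, whose body after T is literally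
the antecedent of GreenKuboOfNoDrude) gives the stmt-0703 body at T; κ T := greenKuboConductivity of
the Classical.choose witnesses of
ThermodynamicLimit (T > 0, else 1), positive by HasGreenKubo.pos; for a steady-state family the D_N
come from FiniteResponseOfUnique and the
ThermodynamicLimit spec gives D_N → κ T. Provers: import
Literature.MathematicalPhysics.KineticTheory.LangevinChainNESSHolds (or the route
file) for the existence fact.

Rationale: WHY THIS LINE. The card tilted μ_T by time-AVERAGED currents and let τ → ∞ at fixed box; its audit
(refuter-novelty-audit-…-4-g2-0) showed that von
Neumann's theorem then kills the tilt even for the ballistic harmonic chain (single-site time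
averages → 0 in L², the Drude weight lives in
the light-cone sum), and that un-truncating inside the light cone is a cluster-expansion problem,
"not soft". The repair moves the tilt
to time ZERO — bias by the instantaneous CLIPPED current, a bounded finite-range Gibbs perturbation
(explicit, regular, no exponential
moments of the cubic current needed) — and reads the Drude weight off the FIRST-ORDER (Kubo)
response of the Cesàro-averaged quench
current (Mazur1969, Suzuki1971, Doyon2022; the von Neumann/Mazur Hilbert-space machinery is PROVED
in tree,
Literature.Barriers.AtomisticToContinuum.MazurBoundBallistic:
`Mazur.tendsto_inv_mul_integral_inner`), removing the truncation STATICALLY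
in ℋ₀ by unitarity; what remains is isolated honestly as ONE uniform-in-time second-order response
bound (X1: boundedness, not decay, of a
Cesàro-averaged dynamical three-point cumulant — true for the harmonic chain by trace-norm
conservation under the Σ-orthogonalised flow)
and ONE Krylov–Bogoliubov/entropy compactness step (X2). Imported, with dictionary: the
driven/tilted-process construction of stochastic
transport theory run BACKWARDS as an impossibility argument (Chetrite–Touchette
doi:10.1007/s00023-014-0375-8, BertiniEtAl2015;
deterministic tilts Kifer1990, Jakšić–Pillet–Rey-Bellet doi:10.1088/0951-7715/24/3/003): 'tilt by
the current' ↦ e^{εΣF_M(j_x)}μ_T,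
'driven process' ↦ Cesàro limit of the quench, 'rate-function curvature' ↦ truncated Drude weight;
hydrodynamic projections (Doyon2022)
give the first-order identity; response theory of chaotic dynamics (Ruelle2009, van Kampen's
objection) names the risk in X1; convergence
of harmonic quenches to the current-carrying states of SpohnLebowitz1977 (doi:10.1007/bf01010871) is
the calibration. Versus the tree:
FourierGreenKubo attacks C_T ∈ L¹ by decay; LocalOhmRigidity uses the odd sector for OPEN-chain NESS
windows → bounded response; this line
makes the same rigidity statement pay on the CLOSED chain's Green–Kubo side (anti-ballistic half of
stmt-0703), so the shared rigidity
statement is now wanted by two mechanisms, and it yields the unconditional dichotomy theorem; route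
NoHiddenCharges (opened concurrently)
reaches the same target ZeroDrudeWeight (stmt-3657) by CHARGE CLASSIFICATION + completeness + Doyon
projection — this line needs no
classification and no completeness (it trades them for rigidity), and its NoTruncatedDrude +
DrudeFromTruncation close the Cesàro clause of
stmt-3657 on any GibbsHydroStructure witness (stmt-3658 satisfies this line's symmetric set-up), a
second, logically independent proof path.
Negatives index empty; nothing refuted is approached.

RANKED CRUXES. #2 UniformQuadraticResponse (crux) — (card item CurrentSurvives, repaired) for the
symmetric set-up (μ_T, φ), every M > 0 and F = F_M: there are ε₀ > 0 and K such that for 0 < ε ≤ ε₀,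
every τ ≥ 1 and all L ≥ L₀(ε,τ): |τ⁻¹∫₀^τ [⟨F(j_0)∘φ_t⟩_{ν_{ε,L}} − ⟨F(j_0)⟩_{μ_T}] dt − ε·A_M(L,τ)|
≤ K ε², where ν_{ε,L} = e^{εG_L}μ_T/Z, G_L = Σ_{|x|≤L} F(j_x) and A_M(L,τ) = τ⁻¹∫₀^τ Cov_{μ_T}(G_L,
F(j_0)∘φ_t)dt. The uniform-in-time second-order Taylor remainder of the quench response = ½
sup_{ε'≤ε} of the Cesàro-averaged third cumulant κ₃^{ν_ε'}(G_L, G_L, F(j_0)∘φ_t). Harmonic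
calibration (F = id, Gaussian quench, by hand): remainder = ½ε² tr(B̃_t Ã² (1−εÃ)⁻¹), |·| ≤
½ε²‖B̃‖₁‖Ã‖²/(1−ε‖Ã‖) uniformly in t, L. [difficulty: XL] (why it might fail: Chaos may make
F(j_0)∘φ_t respond at second order like a generic range-vt observable, |∂²_ε⟨F(j_0)∘φ_t⟩_ν_ε| ~
(vt)^a, not Cesàro-bounded (van Kampen objection, Ruelle2009); no response bound uniform in t beyond
first order is known for any anharmonic chain.) [Ruelle2009, Doyon2022, Mazur1969, Suzuki1971,
SpohnLebowitz1977, doi:10.1007/bf01010871, Kifer1990, doi:10.1088/0951-7715/24/3/003]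
#3 BoundedOddRigidity (crux) — (the card's named hypothesis OddMacroErgodicity, typed for bounded
observables) for ω₂, lam, β > 0: every probability measure on (ℝ×ℝ)^ℤ that is shift-invariant,
time-invariant for the infinite deterministic pinned chain in the generator sense (∫𝒜f dν = 0, f ∈
C₀¹) and regular (decls IsShiftInvariant / OscillatorChain.IsTimeInvariant /
OscillatorChain.IsRegular of MacroErgodicityHypothesis.lean) gives zero mean to every clipped bond
current, ∫ max(−M, min(M, j_0)) dν = 0 (M > 0). Implied by MacroErgodicityHypothesis + reversal
symmetry of the Gibbs states (support OddRigidityOfMacroErgodicity); implies ZeroCurrentRigidity =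
stmt-AtomisticToContinuum-2739 by dominated convergence (support OddRigidityTransfer, PROVED in the
sketch); false at lam = β = 0 (current-carrying Gaussian stationary states, SpohnLebowitz1977).
Needed only at ONE large M per temperature. [difficulty: open-problem] (why it might fail: Regular
current-carrying invariant states may exist without integrability: KAM/breather tori of the infinite
lattice (FFL1994 p.215) or a hidden quasi-local odd charge Q (state e^(λQ)μ_T, Mazur1969); open for
every deterministic anharmonic chain.) [FritzFunakiLebowitz1994, Bernardin2014, SpohnLebowitz1977,
Mazur1969, GurevichSuhov1976]
#4 QuenchCurrentDies (crux) — (card item TiltedStateLimit, repaired order of limits) for the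
symmetric set-up, M, ε > 0: IF every shift-invariant, time-invariant, regular probability ν has
∫F_M(j_0)dν = 0, THEN ∀δ>0 ∃τ₀ ∀τ≥τ₀ ∃L₀ ∀L≥L₀: |τ⁻¹∫₀^τ[⟨F_M(j_0)∘φ_t⟩_{ν_{ε,L}} −
⟨F_M(j_0)⟩_{μ_T}]dt| ≤ δ. Proof plan (compactness): the Cesàro-averaged quench states ν̄_{τ,L} =
τ⁻¹∫₀^τ(φ_t)_*ν_{ε,L}dt are tight (superstability); L → ∞ limit points are shift-invariant
(shift-covariance + quasi-locality of φ_t + Gibbs mixing) with box entropies ≤ CεM(|Λ| + vτ); τ → ∞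
limit points have specific entropy ≤ CεM, hence (shift-invariance, Markov reference) are regular;
they are time-invariant because ∫𝒜f dν̄_τ = τ⁻¹⟨f∘φ_τ − f⟩ = O(‖f‖_∞/τ) with 𝒜f uniformly integrable
(|𝒜f| ≲ Σ|p| + |q|³ against quartic pinning), and carry the limiting clipped current (bounded
continuous); rigidity forces 0, while ⟨F_M(j_0)⟩_{μ_T} = 0 by reversal symmetry. [difficulty: L]
(why it might fail: Needs light-cone quasi-locality of the infinite QUARTIC-chain flow (L-uniform
box entropies; shift-invariance of limits) and box-regularity from specific entropy w.r.t. a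
non-product Gibbs reference — printed only in parts (LLL1977 a.e. flow, ButtaEtAl2007 bounds).)
[LanfordLebowitzLieb1977, ButtaEtAl2007, Bernardin2014, FritzFunakiLebowitz1994, Georgii2011,
KipnisLandim1999]
#5 GreenKuboOfNoDrude (crux) — IMPORT SLOT ('Green–Kubo minus the ballistic atom'): for all
parameters > 0 and T > 0, IF for every symmetric set-up (μ_T, φ) and every M the truncated Drude
weight vanishes in the NoTruncatedDrude form (∀η ∃τ₀ ∀τ≥τ₀ ∃L₀ ∀L≥L₀ |A_M(L,τ)| ≤ η), THEN there are
a Gibbs state and a μ_T-preserving dynamics with HasGreenKubo (C_T absolutely convergent, in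
L¹(0,∞), κ_GK > 0) — literally the body of crux FourierGreenKubo (stmt-AtomisticToContinuum-0703) at
T. NOT this route's mechanism: the residual is the REGULAR part of the current spectral measure σ_T
near 0 (integrable Fourier transform, positive density), the object of cards
herglotz-current-spectral-measure / embedded-drude-eigenvalue-mourre-fgr and of route
FourierGreenKubo; any decay proof of 0703 closes it a fortiori. [deps: NoTruncatedDrude,
SymmetricSetup] [difficulty: open-problem] (why it might fail: It is stmt-0703 minus σ_T(0) = 0: C_T
may fail to be L¹ with no atom at 0 (singular-continuous σ_T near 0, breather tails) or κ_GK may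
vanish; and the antecedent is vacuous unless the symmetric set-up exists (support SymmetricSetup).)
[BonettoLebowitzReyBellet2000, Bernardin2014, Mazur1969, Suzuki1971, CanestrariLiveraniOlla2026]
#9 NoTruncatedDrude (support) — THE DELIVERABLE (no ballistic channel, truncated form): for every
symmetric set-up (μ_T, φ) of pinnedChain (ω₂, lam, β > 0), T > 0, every M, η > 0: ∃τ₀ ∀τ≥τ₀ ∃L₀
∀L≥L₀ |τ⁻¹∫₀^τ Cov_{μ_T}(G_L, F_M(j_0)∘φ_t)dt| ≤ η. Closed by BridgeGlue from ranks 2–4; stated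
alone so that FourierGreenKubo (Cesàro half of stmt-0703), the Herglotz card and the junction/Fekete
lines can want it. [difficulty: L] [Mazur1969, Suzuki1971, Doyon2022]
#9 BridgeGlue (support) — UniformQuadraticResponse → QuenchCurrentDies → BoundedOddRigidity →
NoTruncatedDrude: pure logic plus |εX| ≤ |Y − εX| + |Y| with ε = min(ε₀, η/(2(|K|+1))), δ = εη/2
(PROVED in the planner's Sketch.lean, theorem bridgeGlue, rc 0 — a prover may copy it). [difficulty:
provable-now] [Mazur1969, folklore (planner Sketch.lean theorem bridgeGlue)]
#9 FluctuationStateDichotomy (support) — THE CARD'S BY-PRODUCT THEOREM (contrapositive reading of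
ranks 2 + 4, no rigidity hypothesis): for a symmetric set-up and M > 0, if the truncated Drude
weight does NOT vanish (∃η>0 such that for unboundedly many τ and, given τ, unboundedly many L,
|A_M(L,τ)| > η), then there is a shift-invariant, time-invariant, REGULAR probability measure of the
infinite pinned chain with non-zero mean clipped current — a non-Gibbsian space-time-invariant state
manufactured from equilibrium current fluctuations (harmonic picture: the current-carrying Gaussian
states of SpohnLebowitz1977). Pure logic from UniformQuadraticResponse ∧ QuenchCurrentDies (PROVED
in the sketch, theorem dichotomy_of). [difficulty: provable-now] [SpohnLebowitz1977,
doi:10.1007/bf01010871, FritzFunakiLebowitz1994]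
#9 DrudeFromTruncation (support) — TRANSLATION TO THE CLASSICAL DRUDE WEIGHT: for a symmetric set-up
whose current correlations converge absolutely at all times (HasAbsConvergentCorrelation, as inside
HasGreenKubo), NoTruncatedDrude at (μ_T, φ) for all M implies τ⁻¹∫₀^τ currentCorrelation dt → 0
(σ_T({0}) = 0). Content: von Neumann in ℋ₀ (PROVED abstractly in tree:
Mazur.tendsto_inv_mul_integral_inner) — Cesàro limits exist and equal ‖P₀·‖²; P₀ is a contraction
and ‖j_0 − F_M(j_0)‖_ℋ₀ → 0 is a STATIC Gibbs estimate (summable covariances of local functions), so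
√D ≤ √D_M + o_M(1); plus the L → ∞ swap at fixed τ (dominated convergence from quasi-locality).
[difficulty: M] [Mazur1969, Suzuki1971, Doyon2022, decl
Literature.Barriers.AtomisticToContinuum.Mazur.tendsto_inv_mul_integral_inner]
#9 OddRigidityOfMacroErgodicity (support) — the catalogue hypothesis implies the crux:
MacroErgodicityHypothesis → (every DLR Gibbs state of pinnedChain at every T' > 0 is
momentum-reversal invariant — the 1-D uniqueness/symmetry input made an explicit hypothesis) →
BoundedOddRigidity (ν = ∫μ_T' π(dT'); F_M(j_0) is bounded and odd under p ↦ −p; Measure.bind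
integral). [difficulty: provable-now] [Bernardin2014, FritzFunakiLebowitz1994, Georgii2011]
#9 OddRigidityTransfer (support) — BoundedOddRigidity → ZeroCurrentRigidity of route
LocalOhmRigidity (consequent = stmt-AtomisticToContinuum-2739 copied verbatim): clip at level n+1
and let n → ∞ by dominated convergence (|F_(n+1)(j_0)| ≤ |j_0| ∈ L¹(ν)). PROVED in the planner's
Sketch.lean (theorem oddRigidityTransfer, rc 0): provers of rank 3 close stmt-2739 as well.
[difficulty: provable-now] [FritzFunakiLebowitz1994, folklore (planner Sketch.lean theorem
oddRigidityTransfer)]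
#9 SymmetricSetup (support) — DE-VACUIFIER / infrastructure (InfiniteVolumeSetup = stmt-0743 of
FourierGreenKubo strengthened by the symmetries this line uses): for ω₂, lam, β > 0 (any γ) and T >
0 there are a DLR Gibbs state μ_T that is shift-invariant and momentum-reversal invariant (1-D
transfer operator e^(−U/2T)e^(−V(q′−q)/T)e^(−U/2T), Hilbert–Schmidt since U ≥ ω₂q²/2: unique, hence
symmetric) and an InfiniteChainDynamics preserving μ_T whose flow commutes with the shift μ_T-a.e.
(LLL1977 Thm 3 a.e. existence on a shift-invariant tempered carrier + a uniqueness class;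
ButtaEtAl2007 for quartic forces). [difficulty: L] [LanfordLebowitzLieb1977, ButtaEtAl2007,
Georgii2011]
#9 NessUnique (support) — shared verbatim with routes FourierGreenKubo / LocalOhmRigidity /
FeketeResistance (stmt-AtomisticToContinuum-0741): uniqueness of the weak steady state of the finite
Langevin chain for all N, T_L, T_R > 0 (with the landed existence fact it is clause (i) of
FouriersLawFor). [difficulty: M] [CuneoEckmannHairerReyBellet2018, Carmona2007]
#9 FiniteResponseOfUnique (support) — shared verbatim (stmt-AtomisticToContinuum-0717): under
weak-NESS uniqueness the finite-N linear-response limits D_N(T) exist (Hairer–Majda / Rey-Bellet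
differentiability at equilibrium). [difficulty: M] [HairerMajda2009, ReyBellet2003]
#9 ThermodynamicLimit (support) — shared verbatim, IMPORT (stmt-AtomisticToContinuum-0742, crux rank
3 of route FourierGreenKubo, witness form): given Green–Kubo at T, some (μ_T, D) has D_N → κ_GK(D,
μ_T, T) along every steady-state family; not this route's mechanism. [difficulty: open-problem]
[BonettoLebowitzReyBellet2000, ReyBellet2003, KunduDharNarayan2009]

TWO-LAYER PLAN. Foreseen glued splits (nothing filed now): QuenchCurrentDies ⇐ FlowQuasiLocality →
AveragedStateRegularity → QuenchCurrentDies (k = 2: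
light-cone dependence estimates for the quartic-chain flow; then tightness + shift-invariance +
box-regularity-from-specific-entropy +
generator-form invariance of Cesàro limits); UniformQuadraticResponse ⇐ StaticTiltAnalyticity →
CesaroThirdCumulantBound →
UniformQuadraticResponse (k = 2: analyticity in ε of the perturbed 1-D Gibbs state on quasi-local
observables with range-dependent bounds;
then the dynamical input — Cesàro-boundedness of Σ_(x,x') κ₃(F(j_x), F(j_x'), F(j_0)∘φ_t));
SymmetricSetup ⇐ SymmetricGibbs →
CovariantFlow (k = 2). GreenKuboOfNoDrude and ThermodynamicLimit split, if ever, inside route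
FourierGreenKubo.

KILL CRITERIA. (a) A shift-invariant, regular, time-invariant state of the infinite chain with
non-zero clipped current at some lam, β > 0 refutes
BoundedOddRigidity → close `refuted:BoundedOddRigidity` (it also breaks LocalOhmRigidity's stmt-2739
when j_0 is ν-integrable; if the
witness is a conserved odd charge, Mazur1969_inequality makes stmt-0703 false and the conjunct
suspect → hand the witness to card
open-chain-mazur-bridge). (b) UniformQuadraticResponse refuted (analytic counterexample, or
certified growth of the second-order remainder
with τ) kills THIS line's bridge only → pivot once to the convexity variant (free-energy lower bound
f_τ(λ) ≥ cλ²A_τ for the DYNAMIC tilt by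
time-averaged clipped currents, L → ∞ first) or close `refuted:UniformQuadraticResponse`. (c)
QuenchCurrentDies refuted because Cesàro quench
limits fail box-regularity → restate with specific-entropy regularity (new decl) or close. (d)
stmt-0703 proved by decay elsewhere moots
ranks 2, 4, 5 (NoTruncatedDrude follows); the route then survives only through rank 3's cross-route
role → close `superseded`.
(e) MacroErgodicityHypothesis proved ⇒ rank 3 closes via OddRigidityOfMacroErgodicity.

NOT DECOMPOSED YET. The light-cone quasi-locality lemma for the quartic-chain flow, superstability
tightness of bounded finite-range perturbations, and
box-regularity from specific entropy against a Markov (non-product) Gibbs reference (layer-2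
children of QuenchCurrentDies); the static
analyticity and the dynamical three-point bound behind UniformQuadraticResponse; 1-D DLR uniqueness
/ reversal symmetry (inside
SymmetricSetup and OddRigidityOfMacroErgodicity); the harmonic calibration as a TYPED item (needs a
harmonic InfiniteChainDynamics object,
not in tree — recorded as the cheapest falsifier instead); the card's one-bond twin (zero-frequency
bond noise S_∞(0) = 0, a temperature-step
quench) — left to cards macro-ergodicity-parity-antiballistic (its P2) and
escape-deficit-boundary-tail; the passage closed chain → open
chain beyond GreenKuboOfNoDrude + ThermodynamicLimit; the ~40-line wiring item NoTruncatedDrude →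
DrudeFromTruncation → (GibbsHydroStructure
witness of route NoHiddenCharges, stmt-3658) → ZeroDrudeWeight (stmt-3657), to be filed by tenure
once either side moves (item cap at open).

CHEAPEST FALSIFIER. (1) By hand, the harmonic calibration with F = id (allowed there: j is a
quadratic form with small exponential moments): Gaussian quench
e^(εJ_L)μ_T of pinnedChain ω₂ 0 0; the planner's computation gives remainder ½ε² tr(B̃_t Ã²(1−εÃ)⁻¹)
with B̃_t = Σ^½B_tΣ^½ of constant trace
norm under the Σ-orthogonal flow, so UniformQuadraticResponse HOLDS uniformly in t, L and the quench
converges to SpohnLebowitz1977's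
current-carrying states (rank 3 false, dichotomy sharp) — a refuter should re-derive it; a failure
there kills rank 2's mechanism.
(2) kit MD (not in the plancard budget; for refuters): pinnedChain 1 1 1 1, T = 1, equilibrium
Langevin samples reweighted by e^(εG_L)
(L = 64, M = 3, ε ∈ {0.05, 0.1, 0.2}), Hamiltonian evolution, measure [m(ε,L,τ) − εA(L,τ)]/ε² for τ
≤ 500: bounded in τ supports rank 2,
growth ∝ τ refutes it. (3) Lookup (done, negative): no printed 'D > 0 ⇒ regular non-Gibbs invariant
state' or uniform-in-time second-order
response bound for an anharmonic lattice (crossref ×7, frontier, bridges; galaxy saturated this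
hour).

NUMBERS. Harmonic corner: D(T) > 0, J = fluxCoeff·δT independent of N (HarmonicChainBallisticFlux,
in tree); pinned anharmonic numerics: κ(T) finite
with κ ~ T^(−1.35) for the φ⁴ chain (AokiLukkarinenSpohn2006), i.e. D = 0 expected at every T > 0.
Entropy budget of the tilt: specific
relative entropy ≤ 2εM per site (bounded perturbation), independent of τ, L. Items at open: 15 (4
cruxes, 10 support, 1 assembly).

DEFINITION REQUESTS. None filed: the clipped current F_M(j_x), the tilt weight e^(εG_L), the quench
means and the Cesàro coefficients are written inline over
bondCurrentZ / InfiniteChainDynamics.flow / currentCorrelation and the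
MacroErgodicityHypothesis.lean predicates (IsShiftInvariant,
IsTimeInvariant, IsRegular); a readability definition file Theorems/CurrentTiltRigidityDefs.lean
(quenchMean, cesaroKubo) may be posited by
the first prover. No cite facts wanted: the Mazur/von Neumann machinery is proved in
MazurBoundBallistic.lean.

Novelty: Searches (2026-08-15): `lit search --source crossref` ×7 — "current carrying stationary states
infinite harmonic chain" (SpohnLebowitz1977
doi:10.1007/bf01614132; Boldrighini–Pellegrinotti–Triolo 1983 doi:10.1007/bf01010871; Dudnikova 2019
doi:10.1134/s1061920819040034;
Carinci–Giardinà–Presutti 2019 doi:10.1007/s10955-019-02427-9, stochastic), "Drude weight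
pseudolocal conserved charges GGE Doyon"
(Doyon–Spohn doi:10.21468/scipostphys.3.6.039), "entropic fluctuations classical dynamical systems"
(JPR doi:10.1088/0951-7715/24/3/003),
"linear response uniform in time nonlinear response chaotic" (Cessac–Sepulchre 2007, Abramov–Majda
2007: finite-dimensional chaos only),
"large deviations time integrated current Hamiltonian chain anharmonic" (0 relevant), "relaxation
from tilted Gibbs state quench persistent
current classical chain" (quantum GGE papers only), "specific entropy conserved Hamiltonian dynamics
infinite lattice" (0 relevant);
`lit frontier AtomisticToContinuum --since 2020` (30 rows; only CanestrariLiveraniOlla2026 on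
deterministic bulk, unrelated mechanism);
`lit bridges AtomisticToContinuum --cross any` (nothing on tilts/Drude); `lit galaxy search "…"
--star all` ×3 (service saturated, 0 rows);
the local searchd was down (connection reset); the card's own searches and its novelty audit
(Mazur/Suzuki, Gurevich–Suhov, SpohnLebowitz1977,
FFL94, Kifer1990, Chetrite–Touchette, Doyon2022) adopted; `ledger negatives` (0); all 103 cards of
the sub and the 4 open routes re  [refs: 10.1007/bf01614132, 10.1007/bf01010871, 10.1134/s1061920819040034, 10.1007/s10955-019-02427-9, 10.21468/scipostphys.3.6.039, 10.1088/0951-7715/24/3/003, 10.1007/s00220-017-2836-7, doi:10.1007/bf01614132, doi:10.1007/bf01010871, doi:10.1134/s1061920819040034, doi:10.1007/s10955-019-02427-9, doi:10.21468/scipostphys.3.6.039, doi:10.1088/0951-7715/24/3/003, doi:10.1007/s00220-017-2836-7, SpohnLebowit]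

Barriers (technique_class: current-tilt-quench, cesaro-averaging, odd-macroergodicity): - technique_class: current-tilt-quench, cesaro-averaging, odd-macroergodicity
- Literature.Barriers.AtomisticToContinuum.MacroErgodicityBarrier: EMBRACED, not evaded — rank 3 is
the odd sector of the barrier's open auxiliary MacroErgodicityHypothesis (strictly weaker: no
classification of invariant states; OddRigidityOfMacroErgodicity records the implication); the
barrier's formal kernel (sector-condition failure, SectorCondition.eq_zero_of_symm_zero) is
irrelevant because no hydrodynamic limit, one-block estimate or fluctuation–dissipation
decomposition is taken — the payoff is extracted by a quench + compactness; the bet is that the odd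
sector is provable where the full classification is not.
- Literature.Barriers.AtomisticToContinuum.Mazur1969_inequality (MazurBoundBallistic): consistent
and USED — a conserved odd charge Q overlapping J makes D > 0 (the entry) and simultaneously refutes
rank 3 (e^(λQ)μ_T is regular, invariant, current-carrying); ranks 2 + 4 turn ANY positive truncated
Drude weight, charge or not, into such a state (FluctuationStateDichotomy), the constructive link
between the two catalogue entries the card promised; the entry's proved von Neumann lemmas are this
line's tools (DrudeFromTruncation).
- Literature.Barriers.AtomisticToContinuum.HarmonicChainBallisticFlux: calibration, not obstruction
— at lam = β = 0 rank 3 is false (SpohnLebowitz1977), D > 0, rank 2 holds (Gaussian computation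
above) and rank 4's contrapositive produces the current-carrying Ga

History (route lifecycle, newest last):
- 2026-08-15T13:41:42Z · CLOSED retired — not-a-thesis: assembly does not conclude the sub-problem Statement (operator:999:1257524)

sub-problem: FouriersLaw · status: closed(retired) · opened planner-plancard-AtomisticToContinuum-Fourier-f15ce483-0 2026-08-15T11:43:55Z · rev 2 · ledger route-AtomisticToContinuum-CurrentTiltRigidity
GENERATED by the gate from the ledger (D-0016/17). Provers cite these decls: `theorem foo : Summit.AtomisticToContinuum.FouriersLaw.Theses.CurrentTiltRigidity.<Decl> := …` in Summits/AtomisticToContinuum/FouriersLaw/Theorems/<Name>.lean.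
-/

namespace Summit.AtomisticToContinuum.FouriersLaw.Theses.CurrentTiltRigidity

open scoped BigOperators Topology Manifold Classical MeasureTheory ProbabilityTheory Matrix InnerProductSpace ComplexConjugate ContinuousMap
open Filter Set Function TopologicalSpace MeasureTheory

attribute [summit_statement] _root_.FouriersLaw

/-- item stmt-AtomisticToContinuum-6019 · crux · rank 2 · closed · moot by None · by planner
why it might fail: Chaos may make F(j_0)∘φ_t respond at second order like a generic range-vt observable, |∂²_ε⟨F(j_0)∘φ_t⟩_ν_ε| ~ (vt)^a, not Cesàro-bounded (van Kampen objection, Ruelle2009); no response bound uniform in t beyond first order is known for any anharmonic chain.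
sources: Ruelle2009, Doyon2022, Mazur1969, Suzuki1971, SpohnLebowitz1977, doi:10.1007/bf01010871
[crux] (card item CurrentSurvives, repaired) for the symmetric set-up (μ_T, φ), every M > 0 and F =
F_M: there are ε₀ > 0 and K such that for 0 < ε ≤ ε₀, every τ ≥ 1 and all L ≥ L₀(ε,τ): |τ⁻¹∫₀^τ
[⟨F(j_0)∘φ_t⟩_{ν_{ε,L}} − ⟨F(j_0)⟩_{μ_T}] dt − ε·A_M(L,τ)| ≤ K ε², where ν_{ε,L} = e^{εG_L}μ_T/Z,
G_L = Σ_{|x|≤L} F(j_x) and A_M(L,τ) = τ⁻¹∫₀^τ Cov_{μ_T}(G_L, F(j_0)∘φ_t)dt. The uniform-in-time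
second-order Taylor remainder of the quench response = ½ sup_{ε'≤ε} of the Cesàro-averaged third
cumulant κ₃^{ν_ε'}(G_L, G_L, F(j_0)∘φ_t). Harmonic calibration (F = id, Gaussian quench, by hand):
remainder = ½ε² tr(B̃_t Ã² (1−εÃ)⁻¹), |·| ≤ ½ε²‖B̃‖₁‖Ã‖²/(1−ε‖Ã‖) uniformly in t, L. [difficulty:
XL] -/
@[route_item "route-AtomisticToContinuum-CurrentTiltRigidity"]
def UniformQuadraticResponse : Prop :=
  ∀ ω₂ lam β γ : ℝ, 0 < ω₂ → 0 < lam → 0 < β → ∀ T : ℝ, 0 < T → ∀ μ : MeasureTheory.Measure Literature.MathematicalPhysics.KineticTheory.HeatConduction.ChainConfig, (Literature.MathematicalPhysics.KineticTheory.HeatConduction.pinnedChain ω₂ lam β γ).IsChainGibbsMeasure T μ → Literature.Barriers.AtomisticToContinuum.HeatConduction.IsShiftInvariant μ → μ.map (fun σ : Literature.MathematicalPhysics.KineticTheory.HeatConduction.ChainConfig => fun x : ℤ => ((σ x).1, -(σ x).2)) = μ → ∀ D : Literature.MathematicalPhysics.KineticTheory.HeatConduction.InfiniteChainDynamics (Literature.MathematicalPhysics.KineticTheory.HeatConduction.pinnedChain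 ω₂ lam β γ), D.PreservesMeasure μ → (∀ t : ℝ, ∀ᵐ σ ∂μ, D.flow t (Literature.Barriers.AtomisticToContinuum.HeatConduction.shift σ) = Literature.Barriers.AtomisticToContinuum.HeatConduction.shift (D.flow t σ)) → ∀ M : ℝ, 0 < M → ∀ F : ℝ → ℝ, F = (fun u : ℝ => max (-M) (min M u)) → ∃ ε₀ : ℝ, 0 < ε₀ ∧ ∃ K : ℝ, ∀ ε : ℝ, 0 < ε → ε ≤ ε₀ → ∀ τ : ℝ, 1 ≤ τ → ∃ L₀ : ℕ, ∀ L : ℕ, L₀ ≤ L → ∀ G : Literature.MathematicalPhysics.KineticTheory.HeatConduction.ChainConfig → ℝ, G = (fun σ : Literature.MathematicalPhysics.KineticTheory.HeatConduction.ChainConfig => ∑ x ∈ Finset.Icc (-(L : ℤ)) (L : ℤ), F ((Literature.MathematicalPhysics.KineticTheory.HeatConduction.pinnedChain ω₂ lam β γ).bondCurrentZ σ x)) → |(τ⁻¹ * ∫ t in (0:ℝ)..τ, ((∫ σ, F ((Literature.MathematicalPhysics.KineticTheory.HeatConduction.pinnedChain ω₂ lam β γ).bondCurrentZ (D.flow t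 σ) 0) * Real.exp (ε * G σ) ∂μ) / (∫ σ, Real.exp (ε * G σ) ∂μ) - ∫ σ, F ((Literature.MathematicalPhysics.KineticTheory.HeatConduction.pinnedChain ω₂ lam β γ).bondCurrentZ (D.flow t σ) 0) ∂μ)) - ε * (τ⁻¹ * ∫ t in (0:ℝ)..τ, ((∫ σ, F ((Literature.MathematicalPhysics.KineticTheory.HeatConduction.pinnedChain ω₂ lam β γ).bondCurrentZ (D.flow t σ) 0) * G σ ∂μ) - (∫ σ, F ((Literature.MathematicalPhysics.KineticTheory.HeatConduction.pinnedChain ω₂ lam β γ).bondCurrentZ (D.flow t σ) 0) ∂μ) * (∫ σ, G σ ∂μ)))| ≤ K * ε ^ 2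

/-- item stmt-AtomisticToContinuum-6020 · crux · rank 3 · closed · moot by None · by planner
why it might fail: Regular current-carrying invariant states may exist without integrability: KAM/breather tori of the infinite lattice (FFL1994 p.215) or a hidden quasi-local odd charge Q (state e^(λQ)μ_T, Mazur1969); open for every deterministic anharmonic chain.
sources: FritzFunakiLebowitz1994, Bernardin2014, SpohnLebowitz1977, Mazur1969, GurevichSuhov1976
[crux] (the card's named hypothesis OddMacroErgodicity, typed for bounded observables) for ω₂, lam,
β > 0: every probability measure on (ℝ×ℝ)^ℤ that is shift-invariant, time-invariant for the infinite
deterministic pinned chain in the generator sense (∫𝒜f dν = 0, f ∈ C₀¹) and regular (decls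
IsShiftInvariant / OscillatorChain.IsTimeInvariant / OscillatorChain.IsRegular of
MacroErgodicityHypothesis.lean) gives zero mean to every clipped bond current, ∫ max(−M, min(M,
j_0)) dν = 0 (M > 0). Implied by MacroErgodicityHypothesis + reversal symmetry of the Gibbs states
(support OddRigidityOfMacroErgodicity); implies ZeroCurrentRigidity = stmt-AtomisticToContinuum-2739
by dominated convergence (support OddRigidityTransfer, PROVED in the sketch); false at lam = β = 0
(current-carrying Gaussian stationary states, SpohnLebowitz1977). Needed only at ONE large M per
temperature. [difficulty: open-problem] -/
@[route_item "route-AtomisticToContinuum-CurrentTiltRigidity"]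
def BoundedOddRigidity : Prop :=
  ∀ ω₂ lam β γ : ℝ, 0 < ω₂ → 0 < lam → 0 < β → ∀ ν : MeasureTheory.Measure Literature.MathematicalPhysics.KineticTheory.HeatConduction.ChainConfig, MeasureTheory.IsProbabilityMeasure ν → Literature.Barriers.AtomisticToContinuum.HeatConduction.IsShiftInvariant ν → (Literature.MathematicalPhysics.KineticTheory.HeatConduction.pinnedChain ω₂ lam β γ).IsTimeInvariant ν → (Literature.MathematicalPhysics.KineticTheory.HeatConduction.pinnedChain ω₂ lam β γ).IsRegular ν → ∀ M : ℝ, 0 < M → ∫ σ, max (-M) (min M ((Literature.MathematicalPhysics.KineticTheory.HeatConduction.pinnedChain ω₂ lam β γ).bondCurrentZ σ 0)) ∂ν = 0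

/-- item stmt-AtomisticToContinuum-6021 · crux · rank 4 · closed · moot by None · by planner
why it might fail: Needs light-cone quasi-locality of the infinite QUARTIC-chain flow (L-uniform box entropies; shift-invariance of limits) and box-regularity from specific entropy w.r.t. a non-product Gibbs reference — printed only in parts (LLL1977 a.e. flow, ButtaEtAl2007 bounds).
sources: LanfordLebowitzLieb1977, ButtaEtAl2007, Bernardin2014, FritzFunakiLebowitz1994, Georgii2011, KipnisLandim1999
[crux] (card item TiltedStateLimit, repaired order of limits) for the symmetric set-up, M, ε > 0: IF
every shift-invariant, time-invariant, regular probability ν has ∫F_M(j_0)dν = 0, THEN ∀δ>0 ∃τ₀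
∀τ≥τ₀ ∃L₀ ∀L≥L₀: |τ⁻¹∫₀^τ[⟨F_M(j_0)∘φ_t⟩_{ν_{ε,L}} − ⟨F_M(j_0)⟩_{μ_T}]dt| ≤ δ. Proof plan
(compactness): the Cesàro-averaged quench states ν̄_{τ,L} = τ⁻¹∫₀^τ(φ_t)_*ν_{ε,L}dt are tight
(superstability); L → ∞ limit points are shift-invariant (shift-covariance + quasi-locality of φ_t +
Gibbs mixing) with box entropies ≤ CεM(|Λ| + vτ); τ → ∞ limit points have specific entropy ≤ CεM,
hence (shift-invariance, Markov reference) are regular; they are time-invariant because ∫𝒜f dν̄_τ =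
τ⁻¹⟨f∘φ_τ − f⟩ = O(‖f‖_∞/τ) with 𝒜f uniformly integrable (|𝒜f| ≲ Σ|p| + |q|³ against quartic
pinning), and carry the limiting clipped current (bounded continuous); rigidity forces 0, while
⟨F_M(j_0)⟩_{μ_T} = 0 by reversal symmetry. [difficulty: L] -/
@[route_item "route-AtomisticToContinuum-CurrentTiltRigidity"]
def QuenchCurrentDies : Prop :=
  ∀ ω₂ lam β γ : ℝ, 0 < ω₂ → 0 < lam → 0 < β → ∀ T : ℝ, 0 < T → ∀ μ : MeasureTheory.Measure Literature.MathematicalPhysics.KineticTheory.HeatConduction.ChainConfig, (Literature.MathematicalPhysics.KineticTheory.HeatConduction.pinnedChain ω₂ lam β γ).IsChainGibbsMeasure T μ → Literature.Barriers.AtomisticToContinuum.HeatConduction.IsShiftInvariant μ → μ.map (fun σ : Literature.MathematicalPhysics.KineticTheory.HeatConduction.ChainConfig => fun x : ℤ => ((σ x).1, -(σ x).2)) = μ → ∀ D : Literature.MathematicalPhysics.KineticTheory.HeatConduction.InfiniteChainDynamics (Literature.MathematicalPhysics.KineticTheory.HeatConduction.pinnedChain ω₂ lam β γ), D.PreservesMeasure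 μ → (∀ t : ℝ, ∀ᵐ σ ∂μ, D.flow t (Literature.Barriers.AtomisticToContinuum.HeatConduction.shift σ) = Literature.Barriers.AtomisticToContinuum.HeatConduction.shift (D.flow t σ)) → ∀ M : ℝ, 0 < M → ∀ F : ℝ → ℝ, F = (fun u : ℝ => max (-M) (min M u)) → (∀ ν : MeasureTheory.Measure Literature.MathematicalPhysics.KineticTheory.HeatConduction.ChainConfig, MeasureTheory.IsProbabilityMeasure ν → Literature.Barriers.AtomisticToContinuum.HeatConduction.IsShiftInvariant ν → (Literature.MathematicalPhysics.KineticTheory.HeatConduction.pinnedChain ω₂ lam β γ).IsTimeInvariant ν → (Literature.MathematicalPhysics.KineticTheory.HeatConduction.pinnedChain ω₂ lam β γ).IsRegular ν → ∫ σ, F ((Literature.MathematicalPhysics.KineticTheory.HeatConduction.pinnedChain ω₂ lam β γ).bondCurrentZ σ 0) ∂ν = 0) → ∀ ε : ℝ, 0 < ε → ∀ δ : ℝ, 0 < δ → ∃ τ₀ : ℝ, ∀ τ : ℝ, τ₀ ≤ τ → ∃ L₀ : ℕ, ∀ L : ℕ, L₀ ≤ L → ∀ G : Literature.MathematicalPhysics.KineticTheory.HeatConduction.ChainConfig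 → ℝ, G = (fun σ : Literature.MathematicalPhysics.KineticTheory.HeatConduction.ChainConfig => ∑ x ∈ Finset.Icc (-(L : ℤ)) (L : ℤ), F ((Literature.MathematicalPhysics.KineticTheory.HeatConduction.pinnedChain ω₂ lam β γ).bondCurrentZ σ x)) → |(τ⁻¹ * ∫ t in (0:ℝ)..τ, ((∫ σ, F ((Literature.MathematicalPhysics.KineticTheory.HeatConduction.pinnedChain ω₂ lam β γ).bondCurrentZ (D.flow t σ) 0) * Real.exp (ε * G σ) ∂μ) / (∫ σ, Real.exp (ε * G σ) ∂μ) - ∫ σ, F ((Literature.MathematicalPhysics.KineticTheory.HeatConduction.pinnedChain ω₂ lam β γ).bondCurrentZ (D.flow t σ) 0) ∂μ))| ≤ δ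

/-- item stmt-AtomisticToContinuum-6022 · crux · rank 5 · closed · moot by None · by planner
why it might fail: It is stmt-0703 minus σ_T(0) = 0: C_T may fail to be L¹ with no atom at 0 (singular-continuous σ_T near 0, breather tails) or κ_GK may vanish; and the antecedent is vacuous unless the symmetric set-up exists (support SymmetricSetup).
sources: BonettoLebowitzReyBellet2000, Bernardin2014, Mazur1969, Suzuki1971, CanestrariLiveraniOlla2026
[crux] IMPORT SLOT ('Green–Kubo minus the ballistic atom'): for all parameters > 0 and T > 0, IF for
every symmetric set-up (μ_T, φ) and every M the truncated Drude weight vanishes in the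
NoTruncatedDrude form (∀η ∃τ₀ ∀τ≥τ₀ ∃L₀ ∀L≥L₀ |A_M(L,τ)| ≤ η), THEN there are a Gibbs state and a
μ_T-preserving dynamics with HasGreenKubo (C_T absolutely convergent, in L¹(0,∞), κ_GK > 0) —
literally the body of crux FourierGreenKubo (stmt-AtomisticToContinuum-0703) at T. NOT this route's
mechanism: the residual is the REGULAR part of the current spectral measure σ_T near 0 (integrable
Fourier transform, positive density), the object of cards herglotz-current-spectral-measure /
embedded-drude-eigenvalue-mourre-fgr and of route FourierGreenKubo; any decay proof of 0703 closes
it a fortiori. [deps: NoTruncatedDrude, SymmetricSetup] [difficulty: open-problem] -/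
@[route_item "route-AtomisticToContinuum-CurrentTiltRigidity"]
def GreenKuboOfNoDrude : Prop :=
  ∀ ω₂ lam β γ : ℝ, 0 < ω₂ → 0 < lam → 0 < β → 0 < γ → ∀ T : ℝ, 0 < T → (∀ μ : MeasureTheory.Measure Literature.MathematicalPhysics.KineticTheory.HeatConduction.ChainConfig, (Literature.MathematicalPhysics.KineticTheory.HeatConduction.pinnedChain ω₂ lam β γ).IsChainGibbsMeasure T μ → Literature.Barriers.AtomisticToContinuum.HeatConduction.IsShiftInvariant μ → μ.map (fun σ : Literature.MathematicalPhysics.KineticTheory.HeatConduction.ChainConfig => fun x : ℤ => ((σ x).1, -(σ x).2)) = μ → ∀ D : Literature.MathematicalPhysics.KineticTheory.HeatConduction.InfiniteChainDynamics (Literature.MathematicalPhysics.KineticTheory.HeatConduction.pinnedChain ω₂ lam β γ), D.PreservesMeasure μ → (∀ t : ℝ, ∀ᵐ σ ∂μ, D.flow t (Literature.Barriers.AtomisticToContinuum.HeatConduction.shift σ) = Literature.Barriers.AtomisticToContinuum.HeatConduction.shift (D.flow t σ)) → ∀ M : ℝ, 0 < M → ∀ F : ℝ → ℝ, F = (fun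 u : ℝ => max (-M) (min M u)) → ∀ η : ℝ, 0 < η → ∃ τ₀ : ℝ, ∀ τ : ℝ, τ₀ ≤ τ → ∃ L₀ : ℕ, ∀ L : ℕ, L₀ ≤ L → ∀ G : Literature.MathematicalPhysics.KineticTheory.HeatConduction.ChainConfig → ℝ, G = (fun σ : Literature.MathematicalPhysics.KineticTheory.HeatConduction.ChainConfig => ∑ x ∈ Finset.Icc (-(L : ℤ)) (L : ℤ), F ((Literature.MathematicalPhysics.KineticTheory.HeatConduction.pinnedChain ω₂ lam β γ).bondCurrentZ σ x)) → |(τ⁻¹ * ∫ t in (0:ℝ)..τ, ((∫ σ, F ((Literature.MathematicalPhysics.KineticTheory.HeatConduction.pinnedChain ω₂ lam β γ).bondCurrentZ (D.flow t σ) 0) * G σ ∂μ) - (∫ σ, F ((Literature.MathematicalPhysics.KineticTheory.HeatConduction.pinnedChain ω₂ lam β γ).bondCurrentZ (D.flow t σ) 0) ∂μ) * (∫ σ, G σ ∂μ)))| ≤ η) → ∃ μ : MeasureTheory.Measure Literature.MathematicalPhysics.KineticTheory.HeatConduction.ChainConfig, (Literature.MathematicalPhysics.KineticTheory.HeatConduction.pinnedChain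 ω₂ lam β γ).IsChainGibbsMeasure T μ ∧ ∃ D : Literature.MathematicalPhysics.KineticTheory.HeatConduction.InfiniteChainDynamics (Literature.MathematicalPhysics.KineticTheory.HeatConduction.pinnedChain ω₂ lam β γ), D.PreservesMeasure μ ∧ D.HasGreenKubo μ T

/-- item stmt-AtomisticToContinuum-0717 · support · rank 9 · closed · proved by Summit.AtomisticToContinuum.FouriersLaw.Theorems.FourierGreenKubo.finiteResponseOfUnique_holds (prover) · by planner
sources: HairerMajda2009, ReyBellet2003
CONDITIONAL FORM OF 0705 (supersedes it as the prover target; refuters pool-5/g3-0: 0705 stand-alone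
quantifies over EVERY steady-state family and is false-prone if weak steady states were non-unique):
assuming UNIQUENESS of weak steady states (IsSteadyState class) for pinnedChain at all N, T_L, T_R >
0, the finite-N linear-response limit D_N(T) = lim_{δ→0, δ≠0} totalCurrent(μ_{N,T+δ/2,T−δ/2})/δ
exists for every T > 0 and N. Content: differentiability at equilibrium of NESS expectations of the
polynomial currents in the bath temperatures (ReyBellet2003 arXiv:math-ph/0303021 Rem 4.4 (51)–(56)
finite-volume Green–Kubo; HairerMajda2009 arXiv:0909.4313 Thm 2.3 framework — their SDE Thm 4.4
Assumption 5 fails here, so verify Assumptions 1–3 via CEHR2018 (2.5)/Carmona2007 Thm 1.1(iv)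
weighted spectral gap). N = 0, 1: totalCurrent ≡ 0, D = 0. Together with 0706 gives 0705. -/
@[route_item "route-AtomisticToContinuum-CurrentTiltRigidity"]
def FiniteResponseOfUnique : Prop :=
  ∀ ω₂ lam β γ : ℝ, 0 < ω₂ → 0 < lam → 0 < β → 0 < γ → (∀ (N : ℕ) (T_L T_R : ℝ), 0 < T_L → 0 < T_R → ∀ μ ν : MeasureTheory.Measure (Literature.MathematicalPhysics.KineticTheory.HeatConduction.PhaseSpace N), (Literature.MathematicalPhysics.KineticTheory.HeatConduction.pinnedChain ω₂ lam β γ).IsSteadyState N T_L T_R μ → (Literature.MathematicalPhysics.KineticTheory.HeatConduction.pinnedChain ω₂ lam β γ).IsSteadyState N T_L T_R ν → μ = ν) → ∀ μ : (N : ℕ) → ℝ → ℝ → MeasureTheory.Measure (Literature.MathematicalPhysics.KineticTheory.HeatConduction.PhaseSpace N), (∀ (N : ℕ) (T_L T_R : ℝ), 0 < T_L → 0 < T_R → (Literature.MathematicalPhysics.KineticTheory.HeatConduction.pinnedChain ω₂ lam β γ).IsSteadyState N T_L T_R (μ N T_L T_R)) → ∀ T : ℝ, 0 < T → ∀ N :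 ℕ, ∃ D : ℝ, Filter.Tendsto (fun δ : ℝ => (Literature.MathematicalPhysics.KineticTheory.HeatConduction.pinnedChain ω₂ lam β γ).totalCurrent (μ N (T + δ / 2) (T - δ / 2)) / δ) (nhdsWithin 0 {(0 : ℝ)}ᶜ) (nhds D)

/-- item stmt-AtomisticToContinuum-0741 · support · rank 9 · closed · proved by Summit.AtomisticToContinuum.FouriersLaw.Theorems.nessUnique_proof (prover) · by planner
[crux] UNIQUENESS OF THE WEAK STEADY STATE (the half of stmt-0706 not covered by the landed fact
Literature.MathematicalPhysics.KineticTheory.HeatConduction.CuneoEckmannHairerReyBellet2018_pinnedChain,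
p3544): for pinnedChain ω₂ lam β γ (all > 0), every N and T_L, T_R > 0, any two measures in the weak
Fokker–Planck class IsSteadyState (probability, ∫ L f dμ = 0 for f ∈ C_c^∞, bond currents
integrable) coincide. Print: uniqueness of the INVARIANT MEASURE of the Langevin semigroup
(CuneoEckmannHairerReyBellet2018 Thm 2.13(1): C1, C2, CA; Carmona2007 Thm 1.1(iii)); the item
additionally needs 'weak stationary probability solution of L*μ = 0 ⇒ P_t-invariant' for this
hypoelliptic L with cubic drift (Echeverría 1982 well-posed martingale problem on C_c^∞ +
non-explosion via e^{θH}; Bogachev–Krylov–Röckner–Shaposhnikov 2015 Ch. 5 is non-degenerate only) —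
the FP-identification lemma is the formal crux. N = 0: PhaseSpace 0 is a point (unique probability
measure); N = 1: both baths on site 0, OU at temperature (T_L+T_R)/2. This is exactly the hypothesis
of FiniteResponse and ThermodynamicLimit and, with the fact, gives clause (i) of FouriersLawFor. -/
@[route_item "route-AtomisticToContinuum-CurrentTiltRigidity"]
def NessUnique : Prop :=
  ∀ ω₂ lam β γ : ℝ, 0 < ω₂ → 0 < lam → 0 < β → 0 < γ → ∀ (N : ℕ) (T_L T_R : ℝ), 0 < T_L → 0 < T_R → ∀ μ ν : MeasureTheory.Measure (Literature.MathematicalPhysics.KineticTheory.HeatConduction.PhaseSpace N), (Literature.MathematicalPhysics.KineticTheory.HeatConduction.pinnedChain ω₂ lam β γ).IsSteadyState N T_L T_R μ → (Literature.MathematicalPhysics.KineticTheory.HeatConduction.pinnedChain ω₂ lam β γ).IsSteadyState N T_L T_R ν → μ = ν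

/-- `NessUnique` holds: proved by `Summit.AtomisticToContinuum.FouriersLaw.Theorems.nessUnique_proof`. -/
theorem NessUnique_holds : NessUnique := _root_.Summit.AtomisticToContinuum.FouriersLaw.Theorems.nessUnique_proof

/-- item stmt-AtomisticToContinuum-0742 · support · rank 9 · open · by planner
sources: BonettoLebowitzReyBellet2000, ReyBellet2003, KunduDharNarayan2009
[crux] THERMODYNAMIC LIMIT OF THE RESPONSE COEFFICIENT, WITNESS FORM (supersedes
stmt-AtomisticToContinuum-0704; refuters g12-0/1/2/3/5: the ∀(μ_T,D) form hid the claim that κ_GK is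
the same for every DLR state and every dynamics). Under weak-NESS uniqueness and T > 0, IF some
Gibbs state with a μ_T-preserving Green–Kubo dynamics exists (hypothesis = GreenKubo at T), THEN
there is such a pair (μ_T, D), fixed before the steady-state family is chosen, such that for every
steady-state family μ and every sequence Dn of finite-volume response coefficients (Dn N =
lim_{δ→0,δ≠0} totalCurrent(μ N (T+δ/2) (T−δ/2))/δ, existence = FiniteResponse, uniqueness of limits
makes Dn canonical) one has Dn → greenKuboConductivity D μ_T T. Content: finite-volume Kubo formula
(ReyBellet2003 Rem 4.4 (56)) + N-uniform decay of equilibrium current correlations of the Langevin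
chain + o(1) boundary layers at the baths; open (BonettoLebowitzReyBellet2000 §7 after (37)). N = 0,
1: Dn = 0, irrelevant to atTop. -/
@[route_item "route-AtomisticToContinuum-CurrentTiltRigidity"]
def ThermodynamicLimit : Prop :=
  ∀ ω₂ lam β γ : ℝ, 0 < ω₂ → 0 < lam → 0 < β → 0 < γ → (∀ (N : ℕ) (T_L T_R : ℝ), 0 < T_L → 0 < T_R → ∀ μ ν : MeasureTheory.Measure (Literature.MathematicalPhysics.KineticTheory.HeatConduction.PhaseSpace N), (Literature.MathematicalPhysics.KineticTheory.HeatConduction.pinnedChain ω₂ lam β γ).IsSteadyState N T_L T_R μ → (Literature.MathematicalPhysics.KineticTheory.HeatConduction.pinnedChain ω₂ lam β γ).IsSteadyState N T_L T_R ν → μ = ν) → ∀ T : ℝ, 0 < T → (∃ μT : MeasureTheory.Measure Literature.MathematicalPhysics.KineticTheory.HeatConduction.ChainConfig, (Literature.MathematicalPhysics.KineticTheory.HeatConduction.pinnedChain ω₂ lam β γ).IsChainGibbsMeasure T μT ∧ ∃ D : Literature.MathematicalPhysics.KineticTheory.HeatConduction.InfiniteChainDynamics (Literature.MathematicalPhysics.KineticTheory.HeatConduction.pinnedChain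 ω₂ lam β γ), D.PreservesMeasure μT ∧ D.HasGreenKubo μT T) → ∃ (μT : MeasureTheory.Measure Literature.MathematicalPhysics.KineticTheory.HeatConduction.ChainConfig) (D : Literature.MathematicalPhysics.KineticTheory.HeatConduction.InfiniteChainDynamics (Literature.MathematicalPhysics.KineticTheory.HeatConduction.pinnedChain ω₂ lam β γ)), (Literature.MathematicalPhysics.KineticTheory.HeatConduction.pinnedChain ω₂ lam β γ).IsChainGibbsMeasure T μT ∧ D.PreservesMeasure μT ∧ D.HasGreenKubo μT T ∧ ∀ μ : (N : ℕ) → ℝ → ℝ → MeasureTheory.Measure (Literature.MathematicalPhysics.KineticTheory.HeatConduction.PhaseSpace N), (∀ (N : ℕ) (T_L T_R : ℝ), 0 < T_L → 0 < T_R → (Literature.MathematicalPhysics.KineticTheory.HeatConduction.pinnedChain ω₂ lam β γ).IsSteadyState N T_L T_R (μ N T_L T_R)) → ∀ Dn : ℕ → ℝ, (∀ N : ℕ, Filter.Tendsto (fun δ : ℝ => (Literature.MathematicalPhysics.KineticTheory.HeatConduction.pinnedChain ω₂ lam β γ).totalCurrent (μ N (T + δ / 2) (T - δ / 2)) / δ)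 (nhdsWithin 0 {(0 : ℝ)}ᶜ) (nhds (Dn N))) → Filter.Tendsto Dn Filter.atTop (nhds (D.greenKuboConductivity μT T))

/-- item stmt-AtomisticToContinuum-6023 · support · rank 9 · closed · moot by None · by planner
sources: Mazur1969, Suzuki1971, Doyon2022
[support] THE DELIVERABLE (no ballistic channel, truncated form): for every symmetric set-up (μ_T,
φ) of pinnedChain (ω₂, lam, β > 0), T > 0, every M, η > 0: ∃τ₀ ∀τ≥τ₀ ∃L₀ ∀L≥L₀ |τ⁻¹∫₀^τ
Cov_{μ_T}(G_L, F_M(j_0)∘φ_t)dt| ≤ η. Closed by BridgeGlue from ranks 2–4; stated alone so that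
FourierGreenKubo (Cesàro half of stmt-0703), the Herglotz card and the junction/Fekete lines can
want it. [difficulty: L] -/
@[route_item "route-AtomisticToContinuum-CurrentTiltRigidity"]
def NoTruncatedDrude : Prop :=
  ∀ ω₂ lam β γ : ℝ, 0 < ω₂ → 0 < lam → 0 < β → ∀ T : ℝ, 0 < T → ∀ μ : MeasureTheory.Measure Literature.MathematicalPhysics.KineticTheory.HeatConduction.ChainConfig, (Literature.MathematicalPhysics.KineticTheory.HeatConduction.pinnedChain ω₂ lam β γ).IsChainGibbsMeasure T μ → Literature.Barriers.AtomisticToContinuum.HeatConduction.IsShiftInvariant μ → μ.map (fun σ : Literature.MathematicalPhysics.KineticTheory.HeatConduction.ChainConfig => fun x : ℤ => ((σ x).1, -(σ x).2)) = μ → ∀ D : Literature.MathematicalPhysics.KineticTheory.HeatConduction.InfiniteChainDynamics (Literature.MathematicalPhysics.KineticTheory.HeatConduction.pinnedChain ω₂ lam β γ), D.PreservesMeasure μ → (∀ t : ℝ, ∀ᵐ σ ∂μ, D.flow t (Literature.Barriers.AtomisticToContinuum.HeatConduction.shift σ) = Literature.Barriers.AtomisticToContinuum.HeatConduction.shift (D.flow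 t σ)) → ∀ M : ℝ, 0 < M → ∀ F : ℝ → ℝ, F = (fun u : ℝ => max (-M) (min M u)) → ∀ η : ℝ, 0 < η → ∃ τ₀ : ℝ, ∀ τ : ℝ, τ₀ ≤ τ → ∃ L₀ : ℕ, ∀ L : ℕ, L₀ ≤ L → ∀ G : Literature.MathematicalPhysics.KineticTheory.HeatConduction.ChainConfig → ℝ, G = (fun σ : Literature.MathematicalPhysics.KineticTheory.HeatConduction.ChainConfig => ∑ x ∈ Finset.Icc (-(L : ℤ)) (L : ℤ), F ((Literature.MathematicalPhysics.KineticTheory.HeatConduction.pinnedChain ω₂ lam β γ).bondCurrentZ σ x)) → |(τ⁻¹ * ∫ t in (0:ℝ)..τ, ((∫ σ, F ((Literature.MathematicalPhysics.KineticTheory.HeatConduction.pinnedChain ω₂ lam β γ).bondCurrentZ (D.flow t σ) 0) * G σ ∂μ) - (∫ σ, F ((Literature.MathematicalPhysics.KineticTheory.HeatConduction.pinnedChain ω₂ lam β γ).bondCurrentZ (D.flow t σ) 0) ∂μ) * (∫ σ, G σ ∂μ)))| ≤ η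

/-- item stmt-AtomisticToContinuum-6024 · support · rank 9 · closed · moot by None · by planner
sources: Mazur1969, folklore (planner Sketch.lean theorem bridgeGlue)
[support] UniformQuadraticResponse → QuenchCurrentDies → BoundedOddRigidity → NoTruncatedDrude: pure
logic plus |εX| ≤ |Y − εX| + |Y| with ε = min(ε₀, η/(2(|K|+1))), δ = εη/2 (PROVED in the planner's
Sketch.lean, theorem bridgeGlue, rc 0 — a prover may copy it). [difficulty: provable-now] -/
@[route_item "route-AtomisticToContinuum-CurrentTiltRigidity"]
def BridgeGlue : Prop :=
  UniformQuadraticResponse → QuenchCurrentDies → BoundedOddRigidity → NoTruncatedDrude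

/-- item stmt-AtomisticToContinuum-6025 · support · rank 9 · closed · moot by None · by planner
sources: SpohnLebowitz1977, doi:10.1007/bf01010871, FritzFunakiLebowitz1994
[support] THE CARD'S BY-PRODUCT THEOREM (contrapositive reading of ranks 2 + 4, no rigidity
hypothesis): for a symmetric set-up and M > 0, if the truncated Drude weight does NOT vanish (∃η>0
such that for unboundedly many τ and, given τ, unboundedly many L, |A_M(L,τ)| > η), then there is a
shift-invariant, time-invariant, REGULAR probability measure of the infinite pinned chain with
non-zero mean clipped current — a non-Gibbsian space-time-invariant state manufactured from
equilibrium current fluctuations (harmonic picture: the current-carrying Gaussian states of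
SpohnLebowitz1977). Pure logic from UniformQuadraticResponse ∧ QuenchCurrentDies (PROVED in the
sketch, theorem dichotomy_of). [difficulty: provable-now] -/
@[route_item "route-AtomisticToContinuum-CurrentTiltRigidity"]
def FluctuationStateDichotomy : Prop :=
  ∀ ω₂ lam β γ : ℝ, 0 < ω₂ → 0 < lam → 0 < β → ∀ T : ℝ, 0 < T → ∀ μ : MeasureTheory.Measure Literature.MathematicalPhysics.KineticTheory.HeatConduction.ChainConfig, (Literature.MathematicalPhysics.KineticTheory.HeatConduction.pinnedChain ω₂ lam β γ).IsChainGibbsMeasure T μ → Literature.Barriers.AtomisticToContinuum.HeatConduction.IsShiftInvariant μ → μ.map (fun σ : Literature.MathematicalPhysics.KineticTheory.HeatConduction.ChainConfig => fun x : ℤ => ((σ x).1, -(σ x).2)) = μ → ∀ D : Literature.MathematicalPhysics.KineticTheory.HeatConduction.InfiniteChainDynamics (Literature.MathematicalPhysics.KineticTheory.HeatConduction.pinnedChain ω₂ lam β γ), D.PreservesMeasure μ → (∀ t : ℝ, ∀ᵐ σ ∂μ, D.flow t (Literature.Barriers.AtomisticToContinuum.HeatConduction.shift σ) = Literature.Barriers.AtomisticToContinuum.HeatConduction.shift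 (D.flow t σ)) → ∀ M : ℝ, 0 < M → ∀ F : ℝ → ℝ, F = (fun u : ℝ => max (-M) (min M u)) → (∃ η : ℝ, 0 < η ∧ ∀ τ₀ : ℝ, ∃ τ : ℝ, τ₀ ≤ τ ∧ ∀ L₀ : ℕ, ∃ L : ℕ, L₀ ≤ L ∧ ∀ G : Literature.MathematicalPhysics.KineticTheory.HeatConduction.ChainConfig → ℝ, G = (fun σ : Literature.MathematicalPhysics.KineticTheory.HeatConduction.ChainConfig => ∑ x ∈ Finset.Icc (-(L : ℤ)) (L : ℤ), F ((Literature.MathematicalPhysics.KineticTheory.HeatConduction.pinnedChain ω₂ lam β γ).bondCurrentZ σ x)) → η < |(τ⁻¹ * ∫ t in (0:ℝ)..τ, ((∫ σ, F ((Literature.MathematicalPhysics.KineticTheory.HeatConduction.pinnedChain ω₂ lam β γ).bondCurrentZ (D.flow t σ) 0) * G σ ∂μ) - (∫ σ, F ((Literature.MathematicalPhysics.KineticTheory.HeatConduction.pinnedChain ω₂ lam β γ).bondCurrentZ (D.flow t σ) 0) ∂μ) * (∫ σ, G σ ∂μ)))|) → ∃ ν : MeasureTheory.Measure Literature.MathematicalPhysics.KineticTheory.HeatConduction.ChainConfig,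 MeasureTheory.IsProbabilityMeasure ν ∧ Literature.Barriers.AtomisticToContinuum.HeatConduction.IsShiftInvariant ν ∧ (Literature.MathematicalPhysics.KineticTheory.HeatConduction.pinnedChain ω₂ lam β γ).IsTimeInvariant ν ∧ (Literature.MathematicalPhysics.KineticTheory.HeatConduction.pinnedChain ω₂ lam β γ).IsRegular ν ∧ ∫ σ, F ((Literature.MathematicalPhysics.KineticTheory.HeatConduction.pinnedChain ω₂ lam β γ).bondCurrentZ σ 0) ∂ν ≠ 0

/-- item stmt-AtomisticToContinuum-6026 · support · rank 9 · closed · moot by None · by planner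
sources: Mazur1969, Suzuki1971, Doyon2022, decl Literature.Barriers.AtomisticToContinuum.Mazur.tendsto_inv_mul_integral_inner
[support] TRANSLATION TO THE CLASSICAL DRUDE WEIGHT: for a symmetric set-up whose current
correlations converge absolutely at all times (HasAbsConvergentCorrelation, as inside HasGreenKubo),
NoTruncatedDrude at (μ_T, φ) for all M implies τ⁻¹∫₀^τ currentCorrelation dt → 0 (σ_T({0}) = 0).
Content: von Neumann in ℋ₀ (PROVED abstractly in tree: Mazur.tendsto_inv_mul_integral_inner) —
Cesàro limits exist and equal ‖P₀·‖²; P₀ is a contraction and ‖j_0 − F_M(j_0)‖_ℋ₀ → 0 is a STATIC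
Gibbs estimate (summable covariances of local functions), so √D ≤ √D_M + o_M(1); plus the L → ∞ swap
at fixed τ (dominated convergence from quasi-locality). [difficulty: M] -/
@[route_item "route-AtomisticToContinuum-CurrentTiltRigidity"]
def DrudeFromTruncation : Prop :=
  ∀ ω₂ lam β γ : ℝ, 0 < ω₂ → 0 < lam → 0 < β → ∀ T : ℝ, 0 < T → ∀ μ : MeasureTheory.Measure Literature.MathematicalPhysics.KineticTheory.HeatConduction.ChainConfig, (Literature.MathematicalPhysics.KineticTheory.HeatConduction.pinnedChain ω₂ lam β γ).IsChainGibbsMeasure T μ → Literature.Barriers.AtomisticToContinuum.HeatConduction.IsShiftInvariant μ → μ.map (fun σ : Literature.MathematicalPhysics.KineticTheory.HeatConduction.ChainConfig => fun x : ℤ => ((σ x).1, -(σ x).2)) = μ → ∀ D : Literature.MathematicalPhysics.KineticTheory.HeatConduction.InfiniteChainDynamics (Literature.MathematicalPhysics.KineticTheory.HeatConduction.pinnedChain ω₂ lam β γ), D.PreservesMeasure μ → (∀ t : ℝ, ∀ᵐ σ ∂μ, D.flow t (Literature.Barriers.AtomisticToContinuum.HeatConduction.shift σ) = Literature.Barriers.AtomisticToContinuum.HeatConduction.shift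 (D.flow t σ)) → (∀ t : ℝ, D.HasAbsConvergentCorrelation μ t) → (∀ M : ℝ, 0 < M → ∀ F : ℝ → ℝ, F = (fun u : ℝ => max (-M) (min M u)) → ∀ η : ℝ, 0 < η → ∃ τ₀ : ℝ, ∀ τ : ℝ, τ₀ ≤ τ → ∃ L₀ : ℕ, ∀ L : ℕ, L₀ ≤ L → ∀ G : Literature.MathematicalPhysics.KineticTheory.HeatConduction.ChainConfig → ℝ, G = (fun σ : Literature.MathematicalPhysics.KineticTheory.HeatConduction.ChainConfig => ∑ x ∈ Finset.Icc (-(L : ℤ)) (L : ℤ), F ((Literature.MathematicalPhysics.KineticTheory.HeatConduction.pinnedChain ω₂ lam β γ).bondCurrentZ σ x)) → |(τ⁻¹ * ∫ t in (0:ℝ)..τ, ((∫ σ, F ((Literature.MathematicalPhysics.KineticTheory.HeatConduction.pinnedChain ω₂ lam β γ).bondCurrentZ (D.flow t σ) 0) * G σ ∂μ) - (∫ σ, F ((Literature.MathematicalPhysics.KineticTheory.HeatConduction.pinnedChain ω₂ lam β γ).bondCurrentZ (D.flow t σ) 0) ∂μ) * (∫ σ, G σ ∂μ)))| ≤ η)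 → Filter.Tendsto (fun τ : ℝ => τ⁻¹ * ∫ t in (0:ℝ)..τ, D.currentCorrelation μ t) Filter.atTop (nhds 0)

/-- item stmt-AtomisticToContinuum-6027 · support · rank 9 · closed · moot by None · by planner
sources: Bernardin2014, FritzFunakiLebowitz1994, Georgii2011
[support] the catalogue hypothesis implies the crux: MacroErgodicityHypothesis → (every DLR Gibbs
state of pinnedChain at every T' > 0 is momentum-reversal invariant — the 1-D uniqueness/symmetry
input made an explicit hypothesis) → BoundedOddRigidity (ν = ∫μ_T' π(dT'); F_M(j_0) is bounded and
odd under p ↦ −p; Measure.bind integral). [difficulty: provable-now] -/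
@[route_item "route-AtomisticToContinuum-CurrentTiltRigidity"]
def OddRigidityOfMacroErgodicity : Prop :=
  Literature.Barriers.AtomisticToContinuum.MacroErgodicityHypothesis → (∀ ω₂ lam β γ : ℝ, 0 < ω₂ → 0 < lam → 0 < β → ∀ T : ℝ, 0 < T → ∀ μ : MeasureTheory.Measure Literature.MathematicalPhysics.KineticTheory.HeatConduction.ChainConfig, (Literature.MathematicalPhysics.KineticTheory.HeatConduction.pinnedChain ω₂ lam β γ).IsChainGibbsMeasure T μ → μ.map (fun σ : Literature.MathematicalPhysics.KineticTheory.HeatConduction.ChainConfig => fun x : ℤ => ((σ x).1, -(σ x).2)) = μ) → BoundedOddRigidity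

/-- item stmt-AtomisticToContinuum-6028 · support · rank 9 · closed · moot by None · by planner
sources: FritzFunakiLebowitz1994, folklore (planner Sketch.lean theorem oddRigidityTransfer)
[support] BoundedOddRigidity → ZeroCurrentRigidity of route LocalOhmRigidity (consequent =
stmt-AtomisticToContinuum-2739 copied verbatim): clip at level n+1 and let n → ∞ by dominated
convergence (|F_(n+1)(j_0)| ≤ |j_0| ∈ L¹(ν)). PROVED in the planner's Sketch.lean (theorem
oddRigidityTransfer, rc 0): provers of rank 3 close stmt-2739 as well. [difficulty: provable-now] -/
@[route_item "route-AtomisticToContinuum-CurrentTiltRigidity"]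
def OddRigidityTransfer : Prop :=
  BoundedOddRigidity → ∀ ω₂ lam β γ : ℝ, 0 < ω₂ → 0 < lam → 0 < β → ∀ ν : MeasureTheory.Measure Literature.MathematicalPhysics.KineticTheory.HeatConduction.ChainConfig, MeasureTheory.IsProbabilityMeasure ν → Literature.Barriers.AtomisticToContinuum.HeatConduction.IsShiftInvariant ν → (Literature.MathematicalPhysics.KineticTheory.HeatConduction.pinnedChain ω₂ lam β γ).IsTimeInvariant ν → (Literature.MathematicalPhysics.KineticTheory.HeatConduction.pinnedChain ω₂ lam β γ).IsRegular ν → MeasureTheory.Integrable (fun σ => (Literature.MathematicalPhysics.KineticTheory.HeatConduction.pinnedChain ω₂ lam β γ).bondCurrentZ σ 0) ν → ∫ σ, (Literature.MathematicalPhysics.KineticTheory.HeatConduction.pinnedChain ω₂ lam β γ).bondCurrentZ σ 0 ∂ν = 0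

/-- item stmt-AtomisticToContinuum-6029 · support · rank 9 · closed · moot by None · by planner
sources: LanfordLebowitzLieb1977, ButtaEtAl2007, Georgii2011
[support] DE-VACUIFIER / infrastructure (InfiniteVolumeSetup = stmt-0743 of FourierGreenKubo
strengthened by the symmetries this line uses): for ω₂, lam, β > 0 (any γ) and T > 0 there are a DLR
Gibbs state μ_T that is shift-invariant and momentum-reversal invariant (1-D transfer operator
e^(−U/2T)e^(−V(q′−q)/T)e^(−U/2T), Hilbert–Schmidt since U ≥ ω₂q²/2: unique, hence symmetric) and an
InfiniteChainDynamics preserving μ_T whose flow commutes with the shift μ_T-a.e. (LLL1977 Thm 3 a.e.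
existence on a shift-invariant tempered carrier + a uniqueness class; ButtaEtAl2007 for quartic
forces). [difficulty: L] -/
@[route_item "route-AtomisticToContinuum-CurrentTiltRigidity"]
def SymmetricSetup : Prop :=
  ∀ ω₂ lam β γ : ℝ, 0 < ω₂ → 0 < lam → 0 < β → ∀ T : ℝ, 0 < T → ∃ μ : MeasureTheory.Measure Literature.MathematicalPhysics.KineticTheory.HeatConduction.ChainConfig, (Literature.MathematicalPhysics.KineticTheory.HeatConduction.pinnedChain ω₂ lam β γ).IsChainGibbsMeasure T μ ∧ Literature.Barriers.AtomisticToContinuum.HeatConduction.IsShiftInvariant μ ∧ μ.map (fun σ : Literature.MathematicalPhysics.KineticTheory.HeatConduction.ChainConfig => fun x : ℤ => ((σ x).1, -(σ x).2)) = μ ∧ ∃ D : Literature.MathematicalPhysics.KineticTheory.HeatConduction.InfiniteChainDynamics (Literature.MathematicalPhysics.KineticTheory.HeatConduction.pinnedChain ω₂ lam β γ), D.PreservesMeasure μ ∧ ∀ t : ℝ, ∀ᵐ σ ∂μ, D.flow t (Literature.Barriers.AtomisticToContinuum.HeatConduction.shift σ) = Literature.Barriers.AtomisticToContinuum.HeatConduction.shift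 (D.flow t σ)

/-- item stmt-AtomisticToContinuum-8355 · support · rank 9 · closed · moot by None · by planner
[support] needs-fact marker (route-repair, cone guardrail): the cone fact
Literature.MathematicalPhysics.KineticTheory.HeatConduction.OscillatorChain.CondB1 (LLL 1977
condition B1 — the severed dynamics (9a)–(9c) is global for every finite Λ and every initial point)
in the INSTANTIATED form this line actually uses: for pinnedChain ω₂ lam β γ with ω₂, lam, β ≥ 0 (γ
inert). It is the B1 input of LanfordLebowitzLieb1977_thm3_chain (PROVED in tree:
LanfordLebowitzLieb1977_thm3_chain_holds) on the proof path of support SymmetricSetup (existence of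
a μ_T-preserving infinite-volume dynamics). The bare constant CondB1 is a predicate with a section
variable (P : OscillatorChain) — false for general P (U = −q⁴ blows up) — so the census reads a
hypothesis-predicate as a closed unproved fact; this instance is TRUE and provable now: the severed
energy H_Λ = Σ_{i∈Λ}(p_i²/2 + U(q_i)) + Σ_{bonds meeting Λ} V(q_{j+1} − q_j) (exterior frozen) is
exactly conserved, U, V ≥ 0 give |p_i(t)|² ≤ 2H_Λ(0) and |q_i(t)| ≤ |q_i(0)| + √(2H_Λ(0))·|t|, the
vector field is polynomial, so Picard–Lindelöf + continuation
(Literature.Analysis.ODE.GlobalExistence; Mathlib ODE.PicardLindelof) gives global solutions in b -/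
@[route_item "route-AtomisticToContinuum-CurrentTiltRigidity"]
def SeveredFlowGlobal : Prop :=
  ∀ ω₂ lam β γ : ℝ, 0 ≤ ω₂ → 0 ≤ lam → 0 ≤ β → (Literature.MathematicalPhysics.KineticTheory.HeatConduction.pinnedChain ω₂ lam β γ).CondB1

-- TODO item stmt-AtomisticToContinuum-6030 · assembly · rank 1 · closed · moot by None · by planner — BLOCKED: missing decl(s) NessUnique; restate via `ledger route edit` once they land:
--   def Assembly : Prop := NessUnique → FiniteResponseOfUnique → UniformQuadraticResponse → QuenchCurrentDies → BoundedOddRigidity → GreenKuboOfNoDrude → ThermodynamicLimit → Literature.MathematicalPhysics.KineticTheory.HeatConduction.FouriersLaw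

end Summit.AtomisticToContinuum.FouriersLaw.Theses.CurrentTiltRigidity
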